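import Literature.Probability.RandomPlanarGeometry.SAWTriangularPolygonJoinFinal
import Literature.Probability.RandomPlanarGeometry.SAWTriangularWindow
import HarnessLib

/-!
# Madras' bound on the triangular lattice with an EXPLICIT constant: `q_N(𝕋) ≤ (3·μ(𝕋)⁸ + 2√23·μ(𝕋)²) · N^{−1/2} · μ(𝕋)^N`

Topic `Literature/Probability/RandomPlanarGeometry` (lane «pcv-sawmu», a-p4 g15; sequel of LINE «TRI-MADRAS», whose last module
`SAWTriangularPolygonJoinFinal.lean` proves `SAW.triPolygonNumber_le_rpow_half : ∃ A, ∀ N ≥ 1, q_N(𝕋) ≤ A·N^{−1/2}·μ(𝕋)^N` — Madras'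
`θ ≥ 1/2` on `𝕋` — with an unspecified constant, because the tree's bootstrap `SAWTriangularPolygonMadrasBootstrap.triPolygonNumber_le_rpow_of_joinIneq`
bounds the small lengths by a sum of actual polygon counts; the `ℍ` twin is `HexSAWPolygonMadrasExplicit.lean`, the `ℤ²` one
`SAWPolygonMadrasBound.lean` (`A = 2μ¹⁶`)).

Inputs, all tree theorems: (i) the join inequality WITH ITS CONSTANT, `(1/3)·√N·q_N(𝕋)² ≤ q_{2N+8}(𝕋)` for `N ≥ 3`
(`joinIneqTri_of_spec (joinMapSpecTri_holds hN)`: `SAWTriangularPolygonJoinSpec` + `…JoinFinal`); (ii) the envelope `q_N(𝕋) ≤ 2·μ(𝕋)^N` (`N ≥ 3`,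
`SAWTriangularPolygonSupermult.triPolygonNumber_le_pow`, Madras–Slade (3.2.5) on `𝕋`) and monotonicity `q_N ≤ q_{N+1}` (`triPolygonNumber_le_succ`);
(iii) Madras' doubling lemma with constant ONE (`Literature.Analysis.Asymptotics.Madras1995_doubling_polynomial`); (iv) for the round form only,
`μ(𝕋) ≤ 5` (`SAWTriangularWindow.logMuTri_le_log_five`, axioms standard — the sharper tree bound `μ(𝕋) ≤ 4.271` rests on `native_decide` and is NOT used).

## Contents (namespace `Literature.Probability.RandomPlanarGeometry.SAW`; all `theorem`s, no `def`, no named-fact hypothesis)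
* `triPolygonNumber_joinIneq_explicit` — `(1/3)·√N·q_N(𝕋)² ≤ q_{2N+8}(𝕋)`, `N ≥ 3`;
* `triPolygonNumber_le_two_mul_sq_mul_pow` — the envelope on all lengths: `q_N(𝕋) ≤ 2μ(𝕋)²·μ(𝕋)^N`, `N ≥ 1`;
* **`triPolygonNumber_le_rpow_of_joinIneq_explicit`** — the tree's bootstrap re-run with the EXPLICIT constant `A = μ^K/c + 2μ²·√(N₀+2K+4)`
  (same proof; the small lengths `N < N₀+2K+4` bounded by the envelope instead of by `Σ_{j<M₁} q_j·j`);
* **`triPolygonNumber_le_explicit`** — `∀ N ≥ 1, q_N(𝕋) ≤ (3·μ(𝕋)⁸ + 2·√23·μ(𝕋)²) · N^{−1/2} · μ(𝕋)^N`;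
* **`triPolygonNumber_le_rpow_half_explicit`** — the round form `∀ N ≥ 1, q_N(𝕋) ≤ 1.2·10⁶ · N^{−1/2} · μ(𝕋)^N` (via `μ(𝕋) ≤ 5`).

Sources.  N. Madras, J. Stat. Phys. 78 (1995) 681–699 [Madras1995LatticeAnimalsExponent], §2 (`p_n ≤ A n^{−1/2} μ^n` on `ℤ²`; primary not held —
reported in A. Hammond, arXiv:1504.05286v5 [Hammond2015SAPJoining], §2 p. 4, and in S. G. Whittington, LNP 775 (2009) §2.5 eq. (2.24));
N. Madras, G. Slade, *The Self-Avoiding Walk* (1993) [MadrasSlade1993], Theorem 3.2.3 pp. 64–65.  Status in print (lane cells, LINE «TRI-MADRAS»):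
a triangular-lattice edition of Madras' bound is not located in print; NEW IN WRITING here is only the bookkeeping of the constant (modest).
The constant is far from optimal; no attempt is made to improve it.
-/

noncomputable section

open Filter Topology Finset Literature.Probability.LatticeModels Literature.Analysis.Asymptotics

namespace Literature.Probability.RandomPlanarGeometry.SAW

/-! ### Inputs with their constants -/

/-- **The join inequality on `𝕋` with its constant**: `(1/3)·√N·q_N(𝕋)² ≤ q_{2N+8}(𝕋)` for every `N ≥ 3`.
[cite: Madras1995LatticeAnimalsExponent, §2 (p_{2n+K} ≥ c n^{1/2} p_n²)] [cite: Hammond2015SAPJoining, §3.4 eq. (3.6) and §4.1 (arXiv v5)] -/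
theorem triPolygonNumber_joinIneq_explicit {N : ℕ} (hN : 3 ≤ N) :
    1 / 3 * Real.sqrt N * (triPolygonNumber N : ℝ) ^ 2 ≤ triPolygonNumber (2 * N + 8) :=
  joinIneqTri_of_spec (joinMapSpecTri_holds hN)

/-- **The envelope at every length**: `q_N(𝕋) ≤ 2·μ(𝕋)²·μ(𝕋)^N` for all `N ≥ 1` (`N ≥ 3`: Madras–Slade (3.2.5) on `𝕋`, `q_N ≤ 2μ^N`;
`N ∈ {1, 2}`: `q_N ≤ q_3 ≤ 2μ³` by monotonicity in the length). [cite: MadrasSlade1993, Theorem 3.2.3 (3.2.3), (3.2.5) p. 65] -/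
theorem triPolygonNumber_le_two_mul_sq_mul_pow {N : ℕ} (hN : 1 ≤ N) :
    (triPolygonNumber N : ℝ) ≤ 2 * Real.exp logMuTri ^ 2 * Real.exp logMuTri ^ N := by
  set μ : ℝ := Real.exp logMuTri with hμ
  have hμ1 : 1 ≤ μ := Real.one_le_exp logMuTri_pos.le
  by_cases h3 : 3 ≤ N
  · calc (triPolygonNumber N : ℝ) ≤ 2 * μ ^ N := triPolygonNumber_le_pow h3
      _ = 2 * 1 * μ ^ N := by ring
      _ ≤ 2 * μ ^ 2 * μ ^ N := by
          apply mul_le_mul_of_nonneg_right _ (by positivity)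
          exact mul_le_mul_of_nonneg_left (one_le_pow₀ hμ1) (by norm_num)
  · have hmono : triPolygonNumber N ≤ triPolygonNumber 3 := by
      interval_cases N
      · exact (triPolygonNumber_le_succ 1).trans (triPolygonNumber_le_succ 2)
      · exact triPolygonNumber_le_succ 2
    have h3' : (triPolygonNumber 3 : ℝ) ≤ 2 * μ ^ 3 := triPolygonNumber_le_pow le_rfl
    have hμN : μ ^ 3 ≤ μ ^ 2 * μ ^ N := by
      rw [← pow_add]; exact pow_le_pow_right₀ hμ1 (by omega)
    calc (triPolygonNumber N : ℝ) ≤ triPolygonNumber 3 := by exact_mod_cast hmono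
      _ ≤ 2 * μ ^ 3 := h3'
      _ ≤ 2 * (μ ^ 2 * μ ^ N) := by linarith
      _ = 2 * μ ^ 2 * μ ^ N := by ring

/-! ### The bootstrap with an explicit constant -/

/-- **Madras' doubling bootstrap on `𝕋`, EXPLICIT constant.**  If `c·√N·q_N(𝕋)² ≤ q_{2N+K}(𝕋)` for all `N ≥ N₀` (`c > 0`), then for every
`N ≥ 1`, `q_N(𝕋) ≤ (μ^K/c + 2μ²·√(N₀ + 2K + 4)) · N^{−1/2} · μ^N`, `μ = μ(𝕋)`.  Same proof as the tree's
`triPolygonNumber_le_rpow_of_joinIneq` (auxiliary `a_M = c·q_{M−K}` above the threshold `M₁ = N₀ + 2K + 4`, `Madras1995_doubling_polynomial` with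
`θ = 1/2`); the small lengths `N < M₁` are bounded by the envelope `q_N ≤ 2μ²μ^N ≤ 2μ²√M₁ · N^{−1/2} μ^N` instead of by a sum of polygon counts.
[cite: Madras1995LatticeAnimalsExponent, §2 (primary, not held)] [cite: Hammond2015SAPJoining, §2 (arXiv v5 p. 4)] -/
theorem triPolygonNumber_le_rpow_of_joinIneq_explicit {c : ℝ} {K N₀ : ℕ} (hc : 0 < c)
    (hJ : ∀ N : ℕ, N₀ ≤ N → c * Real.sqrt N * (triPolygonNumber N : ℝ) ^ 2 ≤ triPolygonNumber (2 * N + K)) :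
    ∀ N : ℕ, 1 ≤ N → (triPolygonNumber N : ℝ) ≤
      (Real.exp logMuTri ^ K / c + 2 * Real.exp logMuTri ^ 2 * Real.sqrt ((N₀ + 2 * K + 4 : ℕ) : ℝ)) *
        (N : ℝ) ^ (-(1 / 2 : ℝ)) * Real.exp logMuTri ^ N := by

  set μ : ℝ := Real.exp logMuTri with hμ
  have hμ1 : 1 ≤ μ := Real.one_le_exp logMuTri_pos.le
  have hμ0 : 0 < μ := by positivity
  set q : ℕ → ℝ := fun N => (triPolygonNumber N : ℝ) with hqdef
  have hq0 : ∀ N, 0 ≤ q N := fun N => Nat.cast_nonneg _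
  -- the threshold
  set M₁ : ℕ := N₀ + 2 * K + 4 with hM₁
  -- the auxiliary sequence
  set a : ℕ → ℝ := fun M => if M₁ ≤ M then c * q (M - K) else 0 with hadef
  have ha0 : ∀ n, 1 ≤ n → 0 ≤ a n := fun n _ => by
    simp only [hadef]; split_ifs
    · exact mul_nonneg hc.le (hq0 _)
    · exact le_rfl
  have ha_of_ge : ∀ M, M₁ ≤ M → a M = c * q (M - K) := fun M hM => by simp only [hadef]; rw [if_pos hM]
  -- (hsq): `(√M a_M)² ≤ √(2M) a_{2M}`
  have hsq : ∀ M : ℕ, 1 ≤ M → (((M : ℝ) ^ (1 / 2 : ℝ)) * a M) ^ 2 ≤ ((2 * M : ℕ) : ℝ) ^ (1 / 2 : ℝ) * a (2 * M) := by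
    intro M hM1
    by_cases hM : M₁ ≤ M
    · have h2M : M₁ ≤ 2 * M := by omega
      rw [ha_of_ge M hM, ha_of_ge (2 * M) h2M, ← Real.sqrt_eq_rpow, ← Real.sqrt_eq_rpow]
      have hMK : N₀ ≤ M - K := by omega
      have hJ' := hJ (M - K) hMK
      rw [show 2 * (M - K) + K = 2 * M - K by omega] at hJ'
      have hMKpos : (0 : ℝ) < ((M - K : ℕ) : ℝ) := by exact_mod_cast (show 0 < M - K by omega)
      have hsqrtMK : 0 < Real.sqrt ((M - K : ℕ) : ℝ) := Real.sqrt_pos.2 hMKpos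
      -- `q_{M−K}² ≤ q_{2M−K} / (c √(M−K))`
      have hq2 : q (M - K) ^ 2 ≤ q (2 * M - K) / (c * Real.sqrt ((M - K : ℕ) : ℝ)) := by
        rw [le_div_iff₀ (by positivity)]
        calc q (M - K) ^ 2 * (c * Real.sqrt ((M - K : ℕ) : ℝ)) = c * Real.sqrt ((M - K : ℕ) : ℝ) * q (M - K) ^ 2 := by ring
          _ ≤ q (2 * M - K) := hJ'
      -- `M ≤ √(2M) √(M−K)` since `M ≤ 2(M−K)`
      have hgeo : (M : ℝ) ≤ Real.sqrt ((2 * M : ℕ) : ℝ) * Real.sqrt ((M - K : ℕ) : ℝ) := by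
        rw [← Real.sqrt_mul (by positivity)]
        apply Real.le_sqrt_of_sq_le
        have h1 : ((M : ℕ) : ℝ) ≤ 2 * ((M - K : ℕ) : ℝ) := by
          have : M ≤ 2 * (M - K) := by omega
          exact_mod_cast this
        have hM0 : (0 : ℝ) ≤ M := Nat.cast_nonneg _
        calc ((M : ℝ)) ^ 2 = (M : ℝ) * M := sq _
          _ ≤ (M : ℝ) * (2 * ((M - K : ℕ) : ℝ)) := mul_le_mul_of_nonneg_left h1 hM0
          _ = ((2 * M : ℕ) : ℝ) * ((M - K : ℕ) : ℝ) := by push_cast; ring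
      calc (Real.sqrt (M : ℝ) * (c * q (M - K))) ^ 2 = (M : ℝ) * c ^ 2 * q (M - K) ^ 2 := by
            rw [mul_pow, Real.sq_sqrt (Nat.cast_nonneg _)]; ring
        _ ≤ (M : ℝ) * c ^ 2 * (q (2 * M - K) / (c * Real.sqrt ((M - K : ℕ) : ℝ))) :=
            mul_le_mul_of_nonneg_left hq2 (by positivity)
        _ = (M : ℝ) / Real.sqrt ((M - K : ℕ) : ℝ) * (c * q (2 * M - K)) := by
            field_simp
        _ ≤ Real.sqrt ((2 * M : ℕ) : ℝ) * (c * q (2 * M - K)) := by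
            apply mul_le_mul_of_nonneg_right _ (mul_nonneg hc.le (hq0 _))
            rw [div_le_iff₀ hsqrtMK]; exact hgeo
    · -- below the threshold `a_M = 0`
      have : a M = 0 := by simp only [hadef]; rw [if_neg hM]
      rw [this, mul_zero, zero_pow two_ne_zero]
      exact mul_nonneg (Real.rpow_nonneg (Nat.cast_nonneg _) _) (ha0 _ (by omega))
  -- (hlim): `a_n^{1/n} → μ`
  have hKlim : Tendsto (fun n : ℕ => n - K) atTop atTop := tendsto_sub_atTop_nat K
  have hlog : Tendsto (fun n : ℕ => Real.log (a n) / n) atTop (𝓝 logMuTri) := by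
    -- `log a_n / n = log c / n + (log q_{n−K} / (n−K)) · ((n−K)/n)`
    have h1 : Tendsto (fun n : ℕ => Real.log c / n) atTop (𝓝 0) :=
      tendsto_const_nhds.div_atTop tendsto_natCast_atTop_atTop
    have h2 : Tendsto (fun n : ℕ => Real.log (q (n - K)) / ((n - K : ℕ) : ℝ)) atTop (𝓝 logMuTri) :=
      tendsto_log_triPolygonNumber_div.comp hKlim
    have h3 : Tendsto (fun n : ℕ => (((n - K : ℕ) : ℝ)) / n) atTop (𝓝 1) := by
      have h31 : Tendsto (fun n : ℕ => (1 : ℝ) - (K : ℝ) / n) atTop (𝓝 (1 - 0)) :=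
        tendsto_const_nhds.sub (tendsto_const_nhds.div_atTop tendsto_natCast_atTop_atTop)
      rw [sub_zero] at h31
      refine h31.congr' ?_
      filter_upwards [eventually_ge_atTop (K + 1)] with n hn
      have hn0 : (n : ℝ) ≠ 0 := by exact_mod_cast (show n ≠ 0 by omega)
      rw [Nat.cast_sub (by omega)]
      field_simp
    have h4 := h1.add (h2.mul h3)
    rw [zero_add, mul_one] at h4
    refine h4.congr' ?_
    filter_upwards [eventually_ge_atTop (M₁ + 1)] with n hn
    have hnK : 4 ≤ n - K := by omega
    have hqpos : 0 < q (n - K) := by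
      show (0 : ℝ) < (triPolygonNumber (n - K) : ℝ); exact_mod_cast triPolygonNumber_pos hnK
    have hn0 : (n : ℝ) ≠ 0 := by exact_mod_cast (show n ≠ 0 by omega)
    have hnK0 : ((n - K : ℕ) : ℝ) ≠ 0 := by exact_mod_cast (show n - K ≠ 0 by omega)
    rw [ha_of_ge n (by omega), Real.log_mul hc.ne' hqpos.ne']
    field_simp
  have hlim : Tendsto (fun n : ℕ => a n ^ (1 / (n : ℝ))) atTop (𝓝 μ) := by
    have hexp := (Real.continuous_exp.tendsto _).comp hlog
    refine hexp.congr' ?_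
    filter_upwards [eventually_ge_atTop (M₁ + 1)] with n hn
    have hnK : 4 ≤ n - K := by omega
    have hqpos : 0 < q (n - K) := by
      show (0 : ℝ) < (triPolygonNumber (n - K) : ℝ); exact_mod_cast triPolygonNumber_pos hnK
    have hapos : 0 < a n := by rw [ha_of_ge n (by omega)]; exact mul_pos hc hqpos
    simp only [Function.comp]
    rw [Real.rpow_def_of_pos hapos, one_div, ← div_eq_mul_inv]
  -- apply the doubling lemma with `θ = 1/2`
  have hmain : ∀ N : ℕ, 1 ≤ N → a N ≤ (N : ℝ) ^ (-(1 / 2 : ℝ)) * μ ^ N :=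
    fun N hN => Madras1995_doubling_polynomial ha0 hsq hlim hN
  -- constants (explicit)
  set B : ℝ := 2 * μ ^ 2 * Real.sqrt (M₁ : ℝ) with hB
  have hB0 : 0 ≤ B := by positivity
  intro N hN
  show q N ≤ (μ ^ K / c + B) * (N : ℝ) ^ (-(1 / 2 : ℝ)) * μ ^ N
  have hN0 : (0 : ℝ) < N := by exact_mod_cast (show 0 < N by omega)
  have hrpow : (N : ℝ) ^ (-(1 / 2 : ℝ)) = 1 / Real.sqrt N := by
    rw [Real.rpow_neg hN0.le, ← Real.sqrt_eq_rpow, one_div]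
  have hsqrtN : 0 < Real.sqrt N := Real.sqrt_pos.2 hN0
  by_cases hbig : M₁ ≤ N + K
  · -- `c q_N = a (N+K) ≤ (N+K)^{-1/2} μ^{N+K} ≤ N^{-1/2} μ^K μ^N`
    have h1 := hmain (N + K) (by omega)
    rw [ha_of_ge (N + K) hbig, show N + K - K = N by omega] at h1
    have hNK0 : (0 : ℝ) < ((N + K : ℕ) : ℝ) := by exact_mod_cast (show 0 < N + K by omega)
    have hmono : ((N + K : ℕ) : ℝ) ^ (-(1 / 2 : ℝ)) ≤ (N : ℝ) ^ (-(1 / 2 : ℝ)) := by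
      rw [Real.rpow_neg hNK0.le, Real.rpow_neg hN0.le, ← Real.sqrt_eq_rpow, ← Real.sqrt_eq_rpow]
      exact inv_anti₀ hsqrtN (Real.sqrt_le_sqrt (by exact_mod_cast (show N ≤ N + K by omega)))
    have h2 : c * q N ≤ (N : ℝ) ^ (-(1 / 2 : ℝ)) * (μ ^ K * μ ^ N) := by
      calc c * q N ≤ ((N + K : ℕ) : ℝ) ^ (-(1 / 2 : ℝ)) * μ ^ (N + K) := h1
        _ ≤ (N : ℝ) ^ (-(1 / 2 : ℝ)) * μ ^ (N + K) := mul_le_mul_of_nonneg_right hmono (by positivity)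
        _ = (N : ℝ) ^ (-(1 / 2 : ℝ)) * (μ ^ K * μ ^ N) := by rw [pow_add]; ring
    have h3 : q N ≤ μ ^ K / c * (N : ℝ) ^ (-(1 / 2 : ℝ)) * μ ^ N := by
      rw [div_mul_eq_mul_div, div_mul_eq_mul_div, le_div_iff₀ hc]
      calc q N * c = c * q N := mul_comm _ _
        _ ≤ (N : ℝ) ^ (-(1 / 2 : ℝ)) * (μ ^ K * μ ^ N) := h2
        _ = μ ^ K * (N : ℝ) ^ (-(1 / 2 : ℝ)) * μ ^ N := by ring
    calc q N ≤ μ ^ K / c * (N : ℝ) ^ (-(1 / 2 : ℝ)) * μ ^ N := h3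
      _ ≤ (μ ^ K / c + B) * (N : ℝ) ^ (-(1 / 2 : ℝ)) * μ ^ N := by
          have : 0 ≤ (N : ℝ) ^ (-(1 / 2 : ℝ)) * μ ^ N := by positivity
          nlinarith
  · -- small `N < M₁`: `q_N ≤ 2μ²μ^N ≤ 2μ²√M₁ · N^{-1/2} μ^N`
    have hNlt : N < M₁ := by omega
    have hle1 : (1 : ℝ) ≤ Real.sqrt (M₁ : ℝ) * (N : ℝ) ^ (-(1 / 2 : ℝ)) := by
      rw [hrpow, mul_one_div, le_div_iff₀ hsqrtN, one_mul]
      exact Real.sqrt_le_sqrt (by exact_mod_cast hNlt.le)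
    have hμN : 0 ≤ μ ^ N := by positivity
    have henv : q N ≤ 2 * μ ^ 2 * μ ^ N := triPolygonNumber_le_two_mul_sq_mul_pow hN
    have hstep : q N ≤ B * (N : ℝ) ^ (-(1 / 2 : ℝ)) * μ ^ N := by
      calc q N ≤ 2 * μ ^ 2 * μ ^ N := henv
        _ = 2 * μ ^ 2 * 1 * μ ^ N := by rw [mul_one]
        _ ≤ 2 * μ ^ 2 * (Real.sqrt (M₁ : ℝ) * (N : ℝ) ^ (-(1 / 2 : ℝ))) * μ ^ N :=
            mul_le_mul_of_nonneg_right (mul_le_mul_of_nonneg_left hle1 (by positivity)) hμN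
        _ = B * (N : ℝ) ^ (-(1 / 2 : ℝ)) * μ ^ N := by rw [hB]; ring
    calc q N ≤ B * (N : ℝ) ^ (-(1 / 2 : ℝ)) * μ ^ N := hstep
      _ ≤ (μ ^ K / c + B) * (N : ℝ) ^ (-(1 / 2 : ℝ)) * μ ^ N := by
          have : 0 ≤ (N : ℝ) ^ (-(1 / 2 : ℝ)) * μ ^ N := by positivity
          have : 0 ≤ μ ^ K / c := by positivity
          nlinarith

/-! ### The explicit constant on `𝕋` -/

/-- **Madras' bound on the triangular lattice with an explicit constant**: for every `N ≥ 1`,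
`q_N(𝕋) ≤ (3·μ(𝕋)⁸ + 2·√23·μ(𝕋)²) · N^{−1/2} · μ(𝕋)^N` (`c = 1/3`, `K = 8`, `N₀ = 3`: `μ⁸/(1/3) + 2μ²√(3+16+4)`).
[cite: Madras1995LatticeAnimalsExponent, §2 (θ ≥ 1/2 in two dimensions; primary, not held)] [cite: Hammond2015SAPJoining, §2 p. 4 and §4.1 (arXiv v5)] -/
theorem triPolygonNumber_le_explicit {N : ℕ} (hN : 1 ≤ N) :
    (triPolygonNumber N : ℝ) ≤ (3 * Real.exp logMuTri ^ 8 + 2 * Real.sqrt 23 * Real.exp logMuTri ^ 2) *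
      (N : ℝ) ^ (-(1 / 2 : ℝ)) * Real.exp logMuTri ^ N := by
  have h := triPolygonNumber_le_rpow_of_joinIneq_explicit (c := 1 / 3) (K := 8) (N₀ := 3) (by norm_num)
    (fun N hN => triPolygonNumber_joinIneq_explicit hN) N hN
  have hconst : Real.exp logMuTri ^ 8 / (1 / 3 : ℝ) + 2 * Real.exp logMuTri ^ 2 * Real.sqrt ((3 + 2 * 8 + 4 : ℕ) : ℝ) =
      3 * Real.exp logMuTri ^ 8 + 2 * Real.sqrt 23 * Real.exp logMuTri ^ 2 := by
    norm_num; ring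
  rw [hconst] at h
  exact h

/-- **Round form**: `q_N(𝕋) ≤ 1.2·10⁶ · N^{−1/2} · μ(𝕋)^N` for every `N ≥ 1` (`μ(𝕋) ≤ 5` ⇒ `3μ⁸ + 2√23·μ² ≤ 3·5⁸ + 50·4.8 = 1 172 115`).
[cite: Madras1995LatticeAnimalsExponent, §2] [cite: MadrasSlade1993, §1.2 (1.2.5)–(1.2.6) (μ ≤ 2d−1; on 𝕋: μ ≤ 5)] -/
theorem triPolygonNumber_le_rpow_half_explicit {N : ℕ} (hN : 1 ≤ N) :
    (triPolygonNumber N : ℝ) ≤ 1200000 * (N : ℝ) ^ (-(1 / 2 : ℝ)) * Real.exp logMuTri ^ N := by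
  have h := triPolygonNumber_le_explicit hN
  set μ : ℝ := Real.exp logMuTri with hμ
  have hμ0 : 0 ≤ μ := (Real.exp_pos _).le
  have hμ5 : μ ≤ 5 := by
    have := Real.exp_le_exp.2 logMuTri_le_log_five
    rwa [Real.exp_log (by norm_num : (0 : ℝ) < 5)] at this
  have hs23 : Real.sqrt 23 < 4.8 := by rw [Real.sqrt_lt' (by norm_num)]; norm_num
  have hs23' : 0 ≤ Real.sqrt 23 := Real.sqrt_nonneg _
  have hμ8 : μ ^ 8 ≤ 5 ^ 8 := pow_le_pow_left₀ hμ0 hμ5 8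
  have hμ2 : μ ^ 2 ≤ 5 ^ 2 := pow_le_pow_left₀ hμ0 hμ5 2
  have hA : 3 * μ ^ 8 + 2 * Real.sqrt 23 * μ ^ 2 ≤ 1200000 := by
    nlinarith [mul_nonneg hs23' (sq_nonneg μ)]
  have hfac : 0 ≤ (N : ℝ) ^ (-(1 / 2 : ℝ)) * μ ^ N := by positivity
  calc (triPolygonNumber N : ℝ) ≤ _ := h
    _ = (3 * μ ^ 8 + 2 * Real.sqrt 23 * μ ^ 2) * ((N : ℝ) ^ (-(1 / 2 : ℝ)) * μ ^ N) := by ring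
    _ ≤ 1200000 * ((N : ℝ) ^ (-(1 / 2 : ℝ)) * μ ^ N) := mul_le_mul_of_nonneg_right hA hfac
    _ = _ := by ring

end Literature.Probability.RandomPlanarGeometry.SAW

end
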